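import Literature.NumberTheory.EllipticCurves.CMSigmaSqIntegralityProofs
import Literature.NumberTheory.EllipticCurves.X049CanonicalPAdicHeightSqTwoProofs
import Literature.NumberTheory.EllipticCurves.FormalGroupChartUniquenessProofs
import Mathlib.NumberTheory.Padics.Hensel
import HarnessLib

/-!
# The CM sigma function of `X₀(49)` at `p = 2`: Perrin-Riou's Lemme 2 for `v | 2`, and
`(Σ₂, c₂) = (σ_CM², 0)` (proofs only)

Perrin-Riou [Perrin-Riou 1984, Ch. III §1.2, pp. 53–56] attaches to an elliptic curve `E/ℚ` with complex
multiplication by the ring of integers of `K` and to a place `v | p` of `K` with `p` SPLIT in `K` (good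
ordinary reduction; `p = 2` is allowed — her first example, table p. 54, is `y² = 4x³ - 35x - 49`,
`K = ℚ(√-7)`, `s₂ = 1/2`, where `2` splits) the formal CM sigma function
`σ_v(z) = z·exp(-s₂z²/2 - Σ_{k ≥ 2} γ_{2k} z^{2k}/(2k(2k-1)))` (p. 53; `-(log σ_v)″ = x + (a₁² + 4a₂)/12 + s₂`)
and proves, independently of Mazur–Tate («nous en donnons ici une démonstration indépendante», p. 54):

* **Lemme 2.** `σ_v(L_v(t)) ∈ t(1 + tR⟦t⟧)`, `R` the ring of integers of `L_v`.

  *Proof (pp. 54–55).* With `h = σ_v/t` and the complex multiplication `[π*]` (`N(π*) = p`, `π*` a unit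
  at `v`): `h([π*]t)/h(t)^p = c·u(t)`, `u ∈ 1 + tR⟦t⟧` (the function `σ(π*z)/σ(z)^p` is rational on the
  curve with divisor supported on `ker π*`, which reduces injectively); writing `h = ∏(1 - a_n tⁿ)`, the
  first `a_m ∉ R` would make «ce quotient commence[r] par `1 - (π*^m - p)a_m t^m`», a contradiction
  since `π*` is a unit.

This file carries her argument out, in the kernel and binder-free, for **`E = X₀(49) = 49a1 =
[1,-1,0,-2,-1]`, `K = ℚ(√-7)`, `p = 2`** (the curve and prime of LTYZ Thm 1.1 / BCST Thm A), in the
SQUARED currency of the tree (`WeierstrassCurve.IsMazurTateSigmaSqPair`, `PadicSigmaSq.lean`; at `p = 2`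
the sigma function itself need not be `2`-integral, its square is):

* **§1–§2, the complex multiplication `[π*]` on the formal group, explicitly.** Instead of `√-7` we use
  the étale `2`-torsion abscissa `e`, `4e² + 5e + 2 = 0` (`8e + 5 = ±√-7`); then `π* = ϖ = 3 + 4e`
  (`ϖ² - ϖ + 2 = 0`) and `[ϖ]` is Vélu's `2`-isogeny with kernel `{O, (e, -e/2)}` [Vélu 1971] composed
  with the isomorphism `(u, r) = (ϖ⁻¹, eϖ⁻²)` back to `49a1`. `cm7_exists_cmTwoIsogenyDatum` produces, over
  any `ℚ_p` containing such an `e`, a series `T ∈ zℚ_p⟦z⟧` with `log_E(T) = ϖ·log_E` (so `T = [ϖ]`) and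
  the cleared `x`-relation `ϖ²x(T) = x + t/(x - e) + e`, `t = -(14 + 21e)/4`: the candidate
  `T = 2ϖzAB/Q`, `z²x(T) = 4AB³/Q²` is checked against the Weierstrass equation by three polynomial
  identities with machine-generated cofactors (`phi_identity`, `heq_identity`, `star_identity`), the
  uniqueness of the formal chart (`formalXMulSq_subst_eq_of_sq_eq`, `formalEta_subst_mul_eq`) and the
  chain rule for the invariant differential (`ω(T)·T′ = ϖ·ω` ⟹ `log_E(T) = ϖ·log_E`).
* **§3, `p = 2`.** `e ∈ ℤ₂` by Hensel (`√-7 ∈ ℤ₂`), `ϖ ∈ ℤ₂^×`, `T = exp_E(ϖ log_E) ∈ zℤ₂⟦z⟧`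
  (`isPadicInt_formalExp_subst_C_mul_formalLog`); the CM constant of the sigma equation is `c = 0`
  (`= (e - r₀)/(ϖ² - 2)` with `r₀ = e`; equivalently `s₂ = 1/4` on the minimal model, which is Perrin-Riou's
  `s₂ = 1/2` on `y² = 4x³ - 35x - 49 = ` the model `X = 2(x + b₂/12)`, weight `2`). Feeding the datum to
  `isMazurTateSigmaSqPair_sq_of_cmTwoIsogeny_two` (`CMSigmaSqIntegralityProofs`: the functional equation
  `z²σ([ϖ]t)² = ϖ²σ⁴·(X - ez²)` from the sigma equation, then the coefficient induction of
  `UnitSubstitutionIntegrality` — Perrin-Riou's «`1 - (π*^m - p)a_m t^m`» with `N(π*) = p = 2`, where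
  `π*^m - 2` is automatically a `2`-adic unit) gives:

  - `cm7_isMazurTateSigmaSqPair_sq_two`: for EVERY normalised odd formal solution `σ` of `x = -D(Dσ/σ)` on
    `49a1 ⊗ ℚ₂`, `(σ², 0)` is a Mazur–Tate sigma-squared pair (`σ² ∈ z² + z³ℤ₂⟦z⟧`) — Lemme 2 at `v | 2`;
  - `cm7_exists_isMazurTateSigmaSqPair_sq_two`, `cm7_isMazurTateSigmaSqPair_padicSigmaSq_two'`: such a
    `σ` exists (`exists_isFormallyOdd_satisfiesSigmaODE_zero`), so the receptacle `(Σ₂, c₂)` of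
    `PadicSigmaSq.lean` is a genuine sigma-squared pair of `X₀(49) ⊗ ℚ₂` with NO printed-fact binder;
  - `cm7_padicSigmaSq_eq_sq_two`: under the printed uniqueness `mazurTate_sigmaSq_existsUnique_two`
    (Silverman 2005 §5 Rem. 2 / Mazur–Tate 1991 Thm. 3.1), `Σ₂ = σ_CM²` and `c₂ = 0` — statement **(L1)
    «`σ_MT² = σ_CM²`» of the cell's audit at `p = 2`**, i.e. the `2`-adic sigma-squared height of the tree on
    `X₀(49)` is the one built from Perrin-Riou's CM sigma function `σ_v`, `v | 2` (the `v`-part of her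
    `h_ρ`, pp. 56–57).

What is NOT claimed: Lemme 2 for a general CM curve or for `v ∤ 2` (the general `[π*]` is not
constructed here; -- TODO(general form): `E` with CM by `O_K`, any split `v`, via the algebraic
construction of `σ(π*z)/σ(z)^{N π*}`); Lemmes 3–4 (the functions `D_v`, uniqueness up to `μ₁₂`) and the
height `h_ρ` itself (pp. 56–57, Prop. 5); the uniqueness of the sigma-squared pair at `2` without the printed binder.

## References
* [Perrin-Riou 1984] B. Perrin-Riou, *Arithmétique des courbes elliptiques et théorie d'Iwasawa*,
  Mém. SMF 17 (1984), Ch. III §1.2, pp. 53–56 (définition de `σ_v`, table, Lemme 2). [cite: Perrinriou1984, Ch. III §1.2 Lemme 2]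
* [Vélu 1971] J. Vélu, *Isogénies entre courbes elliptiques*, C. R. Acad. Sci. 273 (1971) 238–241. [cite: Velu1971, formules (7)–(11)]
* [Silverman AEC] J. H. Silverman, *The Arithmetic of Elliptic Curves*, 2nd ed., III.4 (Vélu), IV.1–IV.5
  (formal group, `log_E`, `exp_E`, `[m]`). [cite: SilvermanAEC2009, IV.2 and IV.5]
* [Mazur–Tate 1991] B. Mazur, J. Tate, *The `p`-adic sigma function*, Duke Math. J. 62, Thm. 3.1. [cite: MazurTate1991, Thm. 3.1]
* [Silverman 2005] J. H. Silverman, *`p`-adic properties of division polynomials*, Math. Ann. 332, §5 Rem. 2. [cite: Silverman2005DivPoly, §5 Rem. 2]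
* [Mazur–Stein–Tate 2006] *Computation of `p`-adic heights and log convergence*, Doc. Math. Extra Vol., §3.1, Thm. 1.3. [cite: MazurSteinTate2006, Thm. 1.3]
* [Serre 1973] J.-P. Serre, *A Course in Arithmetic*, Ch. II §3.3 (squares in `ℚ₂`). [cite: Serre1973, Ch. II §3.3 Thm. 4]
-/

noncomputable section

open PowerSeries Literature.NumberTheory.EllipticCurves

namespace WeierstrassCurve

/-! ### §1. Three polynomial identities (machine-certified cofactors) -/

section Identities

variable {R : Type*} [CommRing R]

/-- **The `2`-isogeny identity for `X₀(49)` at the formal point, cleared** (`Φ`): with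
`A = X - e z²`, `B = X² + (t - e²)z⁴`, `Ỹ = (z - 2)X`, `ϖ = 3 + 4e`,
`Q = -(A² - t z⁴)Ỹ + ϖ z A B`, the Weierstrass relation of `[1,-1,0,-2,-1]` for `X = z²x(z)`,
`4e² + 5e + 2 = 0` (the étale `2`-torsion abscissa) and `4t = -14 - 21e` (Vélu's `t_Q`) give
`Q² = 4AB³ + 2ϖzABQ - 4ϖ²z²A²B² - 8ϖ⁴z⁴A³B - 4ϖ⁶z⁶A⁴` (times `16`).
[cite: Velu1971, formules (7)–(11)] [folklore] -/
private theorem phi_identity (X Xs e t : R)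
    (hcurve : Xs ^ 2 = Xs ^ 3 + X * Xs ^ 2 - X ^ 2 * Xs ^ 2 - 2 * X ^ 4 * Xs - X ^ 6)
    (he : 4 * e ^ 2 + 5 * e + 2 = 0) (ht : 4 * t = -14 - 21 * e) :
    16 * ((-((Xs - e * X ^ 2) ^ 2 - t * X ^ 4) * ((X - 2) * Xs) + (3 + 4 * e) * X * (Xs - e * X ^ 2) * (Xs ^ 2 + (t - e ^ 2) * X ^ 4)) ^ 2 - (4 * (Xs - e * X ^ 2) * (Xs ^ 2 + (t - e ^ 2) * X ^ 4) ^ 3 + 2 * (3 + 4 * e) * X * (Xs - e * X ^ 2) * (Xs ^ 2 + (t - e ^ 2) * X ^ 4) * (-((Xs - e * X ^ 2) ^ 2 - t * X ^ 4) * ((X - 2) * Xs) + (3 + 4 * e) * X * (Xs - e * X ^ 2) * (Xs ^ 2 + (t - e ^ 2) * X ^ 4)) - 4 * (3 + 4 * e) ^ 2 * X ^ 2 * (Xs - e * X ^ 2) ^ 2 * (Xs ^ 2 + (t - e ^ 2) * X ^ 4) ^ 2 - 8 * (3 + 4 * e) ^ 4 * X ^ 4 * (Xs - e * X ^ 2)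 ^ 3 * (Xs ^ 2 + (t - e ^ 2) * X ^ 4) - 4 * (3 + 4 * e) ^ 6 * X ^ 6 * (Xs - e * X ^ 2) ^ 4)) = 0 := by
  linear_combination ((-32) * X ^ 4 * Xs ^ 4 + (-48) * X ^ 4 * Xs ^ 5 + (32) * X ^ 5 * Xs ^ 4 + (64) * X ^ 6 * Xs ^ 3 * e + (208) * X ^ 6 * Xs ^ 4 + (624) * X ^ 6 * Xs ^ 4 * e + (384) * X ^ 6 * Xs ^ 4 * e ^ 2 + (-64) * X ^ 7 * Xs ^ 3 * e + (-56) * X ^ 8 * Xs ^ 2 + (-84) * X ^ 8 * Xs ^ 2 * e + (-32) * X ^ 8 * Xs ^ 2 * e ^ 2 + (16) * X ^ 8 * Xs ^ 2 * t + (2760) * X ^ 8 * Xs ^ 3 + (13660) * X ^ 8 * Xs ^ 3 * e + (26592) * X ^ 8 * Xs ^ 3 * e ^ 2 + (23808) * X ^ 8 * Xs ^ 3 * e ^ 3 + (8192) * X ^ 8 * Xs ^ 3 * e ^ 4 + (-48) * X ^ 8 * Xs ^ 3 * t + (56) * X ^ 9 * Xs ^ 2 + (84) * X ^ 9 * Xs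 ^ 2 * e + (32) * X ^ 9 * Xs ^ 2 * e ^ 2 + (-16) * X ^ 9 * Xs ^ 2 * t + (-392) * X ^ 10 * Xs ^ 2 + (-9540) * X ^ 10 * Xs ^ 2 * e + (336) * X ^ 10 * Xs ^ 2 * e * t + (-43916) * X ^ 10 * Xs ^ 2 * e ^ 2 + (192) * X ^ 10 * Xs ^ 2 * e ^ 2 * t + (-84048) * X ^ 10 * Xs ^ 2 * e ^ 3 + (-73728) * X ^ 10 * Xs ^ 2 * e ^ 4 + (-24576) * X ^ 10 * Xs ^ 2 * e ^ 5 + (112) * X ^ 10 * Xs ^ 2 * t + (-196) * X ^ 12 * Xs + (168) * X ^ 12 * Xs * e + (-132) * X ^ 12 * Xs * e * t + (10317) * X ^ 12 * Xs * e ^ 2 + (-528) * X ^ 12 * Xs * e ^ 2 * t + (46020) * X ^ 12 * Xs * e ^ 3 + (-384) * X ^ 12 * Xs * e ^ 3 * t + (86064) * X ^ 12 * Xs * e ^ 4 + (74496) * X ^ 12 * Xs * e ^ 5 + (24576) * X ^ 12 * Xs * e ^ 6 + (56) * X ^ 12 * Xs * t + (-16) * X ^ 12 * Xs * t ^ 2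 + (196) * X ^ 14 * e + (-56) * X ^ 14 * e * t + (16) * X ^ 14 * e * t ^ 2 + (210) * X ^ 14 * e ^ 2 + (24) * X ^ 14 * e ^ 2 * t + (-3558) * X ^ 14 * e ^ 3 + (240) * X ^ 14 * e ^ 3 * t + (-15972) * X ^ 14 * e ^ 4 + (192) * X ^ 14 * e ^ 4 * t + (-29184) * X ^ 14 * e ^ 5 + (-24960) * X ^ 14 * e ^ 6 + (-8192) * X ^ 14 * e ^ 7) * ht + ((192) * X ^ 2 * Xs ^ 6 + (96) * X ^ 4 * Xs ^ 4 + (5584) * X ^ 4 * Xs ^ 5 + (13952) * X ^ 4 * Xs ^ 5 * e + (8192) * X ^ 4 * Xs ^ 5 * e ^ 2 + (-96) * X ^ 5 * Xs ^ 4 + (-256) * X ^ 6 * Xs ^ 3 + (-64) * X ^ 6 * Xs ^ 3 * e + (21968) * X ^ 6 * Xs ^ 4 + (110016) * X ^ 6 * Xs ^ 4 * e + (210752) * X ^ 6 * Xs ^ 4 * e ^ 2 + (188416) * X ^ 6 * Xs ^ 4 * e ^ 3 + (65536) * X ^ 6 * Xs ^ 4 * e ^ 4 + (256) * X ^ 7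 * Xs ^ 3 + (64) * X ^ 7 * Xs ^ 3 * e + (360) * X ^ 8 * Xs ^ 2 + (148) * X ^ 8 * Xs ^ 2 * e + (16) * X ^ 8 * Xs ^ 2 * e ^ 2 + (-19800) * X ^ 8 * Xs ^ 3 + (-168604) * X ^ 8 * Xs ^ 3 * e + (-604592) * X ^ 8 * Xs ^ 3 * e ^ 2 + (-1029376) * X ^ 8 * Xs ^ 3 * e ^ 3 + (-835584) * X ^ 8 * Xs ^ 3 * e ^ 4 + (-262144) * X ^ 8 * Xs ^ 3 * e ^ 5 + (-360) * X ^ 9 * Xs ^ 2 + (-148) * X ^ 9 * Xs ^ 2 * e + (-16) * X ^ 9 * Xs ^ 2 * e ^ 2 + (2072) * X ^ 10 * Xs ^ 2 + (64980) * X ^ 10 * Xs ^ 2 * e + (380956) * X ^ 10 * Xs ^ 2 * e ^ 2 + (1097216) * X ^ 10 * Xs ^ 2 * e ^ 3 + (1681216) * X ^ 10 * Xs ^ 2 * e ^ 4 + (1294336) * X ^ 10 * Xs ^ 2 * e ^ 5 + (393216) * X ^ 10 * Xs ^ 2 * e ^ 6 + (1052) * X ^ 12 * Xs + (-2260) * X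 ^ 12 * Xs * e + (-70437) * X ^ 12 * Xs * e ^ 2 + (-343168) * X ^ 12 * Xs * e ^ 3 + (-848912) * X ^ 12 * Xs * e ^ 4 + (-1188224) * X ^ 12 * Xs * e ^ 5 + (-876544) * X ^ 12 * Xs * e ^ 6 + (-262144) * X ^ 12 * Xs * e ^ 7 + (-32) * X ^ 14 + (-1420) * X ^ 14 * e + (86) * X ^ 14 * e ^ 2 + (25326) * X ^ 14 * e ^ 3 + (109004) * X ^ 14 * e ^ 4 + (240640) * X ^ 14 * e ^ 5 + (311488) * X ^ 14 * e ^ 6 + (221184) * X ^ 14 * e ^ 7 + (65536) * X ^ 14 * e ^ 8) * he + ((-256) * X ^ 2 * Xs ^ 3 * e + (256) * X ^ 4 * Xs ^ 2 + (192) * X ^ 4 * Xs ^ 2 * e + (512) * X ^ 6 * Xs + (512) * X ^ 6 * Xs * e + (64) * X ^ 8 + (256) * X ^ 8 * e + (64) * Xs ^ 4) * hcurve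

/-- **The cleared Weierstrass equation of the image point** (`heq` of the chart-uniqueness
lemma) for `τ = 2ϖzABq`, `P = 4AB³q²`, `Qq = 1`, from `Φ` — with `A`, `B`, `Q`, `ϖ` as atoms.
[folklore] -/
private theorem heq_identity (X A B Q q w : R)
    (hΦ : Q ^ 2 = 4 * A * B ^ 3 + 2 * w * X * A * B * Q - 4 * w ^ 2 * X ^ 2 * A ^ 2 * B ^ 2 -
      8 * w ^ 4 * X ^ 4 * A ^ 3 * B - 4 * w ^ 6 * X ^ 6 * A ^ 4)
    (hq : Q * q = 1) :
    (4 * A * B ^ 3 * q ^ 2) ^ 2 = (4 * A * B ^ 3 * q ^ 2) ^ 3 +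
      (2 * w * X * A * B * q) * (4 * A * B ^ 3 * q ^ 2) ^ 2 -
      (2 * w * X * A * B * q) ^ 2 * (4 * A * B ^ 3 * q ^ 2) ^ 2 -
      2 * (2 * w * X * A * B * q) ^ 4 * (4 * A * B ^ 3 * q ^ 2) - (2 * w * X * A * B * q) ^ 6 := by
  have hs : 1 = 4 * A * B ^ 3 * q ^ 2 + 2 * w * X * A * B * q - 4 * w ^ 2 * X ^ 2 * A ^ 2 * B ^ 2 * q ^ 2 -
      8 * w ^ 4 * X ^ 4 * A ^ 3 * B * q ^ 2 - 4 * w ^ 6 * X ^ 6 * A ^ 4 * q ^ 2 := by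
    linear_combination q ^ 2 * hΦ + (2 * w * X * A * B * q - (Q * q + 1)) * hq
  linear_combination (16 * A ^ 2 * B ^ 6 * q ^ 4) * hs

/-- **The chain rule `ξ' = R'(x)x'` for the `x`-coordinate `ξ = P/τ²` of the image point**, in the
form `(τP' - 2Pτ')·Ỹ = ϖ(zX' - 2X)·(τ - 2)P` (`d = X'`, `dq = q'`, `q' = -q²Q'`). [folklore] -/
private theorem star_identity (X Xs e t q d dq : R) (hq : (-((Xs - e * X ^ 2) ^ 2 - t * X ^ 4) * ((X - 2) * Xs) + (3 + 4 * e) * X * (Xs - e * X ^ 2) * (Xs ^ 2 + (t - e ^ 2) * X ^ 4)) * q = 1)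
    :
    ((2 * (3 + 4 * e) * X * (Xs - e * X ^ 2) * (Xs ^ 2 + (t - e ^ 2) * X ^ 4) * q) * (4 * ((d - 2 * e * X) * (Xs ^ 2 + (t - e ^ 2) * X ^ 4) ^ 3 * q ^ 2 + 3 * (Xs - e * X ^ 2) * (Xs ^ 2 + (t - e ^ 2) * X ^ 4) ^ 2 * (2 * Xs * d + 4 * (t - e ^ 2) * X ^ 3) * q ^ 2 + 2 * (Xs - e * X ^ 2) * (Xs ^ 2 + (t - e ^ 2) * X ^ 4) ^ 3 * q * dq)) - 2 * (4 * (Xs - e * X ^ 2) * (Xs ^ 2 + (t - e ^ 2) * X ^ 4) ^ 3 * q ^ 2) * (2 * (3 + 4 * e) * ((Xs - e * X ^ 2) * (Xs ^ 2 + (t - e ^ 2) * X ^ 4) * q + X * ((d - 2 * e * X) * (Xs ^ 2 + (t - e ^ 2) * X ^ 4) * q + (Xs - e * X ^ 2) * (2 * Xs * d + 4 * (t - e ^ 2) * X ^ 3) * q + (Xs - e * X ^ 2) * (Xs ^ 2 + (t - e ^ 2) * X ^ 4) * dq)))) * ((X - 2) * Xs) =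
      (3 + 4 * e) * (X * d - 2 * Xs) * (((2 * (3 + 4 * e) * X * (Xs - e * X ^ 2) * (Xs ^ 2 + (t - e ^ 2) * X ^ 4) * q) - 2) * (4 * (Xs - e * X ^ 2) * (Xs ^ 2 + (t - e ^ 2) * X ^ 4) ^ 3 * q ^ 2)) := by
  linear_combination ((-32) * X * Xs ^ 7 * d * e * q ^ 2 + (-24) * X * Xs ^ 7 * d * q ^ 2 + (-48) * X ^ 2 * Xs ^ 7 * e * q ^ 2 + (-64) * X ^ 2 * Xs ^ 7 * e ^ 2 * q ^ 2 + (24) * X ^ 3 * Xs ^ 6 * d * e * q ^ 2 + (32) * X ^ 3 * Xs ^ 6 * d * e ^ 2 * q ^ 2 + (192) * X ^ 4 * Xs ^ 6 * e * q ^ 2 * t + (-144) * X ^ 4 * Xs ^ 6 * e ^ 2 * q ^ 2 + (-192) * X ^ 4 * Xs ^ 6 * e ^ 3 * q ^ 2 + (144) * X ^ 4 * Xs ^ 6 * q ^ 2 * t + (-96) * X ^ 5 * Xs ^ 5 * d * e * q ^ 2 * t + (72) * X ^ 5 * Xs ^ 5 * d * e ^ 2 * q ^ 2 + (96) * X ^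 5 * Xs ^ 5 * d * e ^ 3 * q ^ 2 + (-72) * X ^ 5 * Xs ^ 5 * d * q ^ 2 * t + (-144) * X ^ 6 * Xs ^ 5 * e * q ^ 2 * t + (-192) * X ^ 6 * Xs ^ 5 * e ^ 2 * q ^ 2 * t + (144) * X ^ 6 * Xs ^ 5 * e ^ 3 * q ^ 2 + (192) * X ^ 6 * Xs ^ 5 * e ^ 4 * q ^ 2 + (72) * X ^ 7 * Xs ^ 4 * d * e * q ^ 2 * t + (96) * X ^ 7 * Xs ^ 4 * d * e ^ 2 * q ^ 2 * t + (-72) * X ^ 7 * Xs ^ 4 * d * e ^ 3 * q ^ 2 + (-96) * X ^ 7 * Xs ^ 4 * d * e ^ 4 * q ^ 2 + (192) * X ^ 8 * Xs ^ 4 * e * q ^ 2 * t ^ 2 + (-288) * X ^ 8 * Xs ^ 4 * e ^ 2 * q ^ 2 * t + (-384) * X ^ 8 * Xs ^ 4 * e ^ 3 * q ^ 2 * t + (144) * X ^ 8 * Xs ^ 4 * e ^ 4 * q ^ 2 + (192) * X ^ 8 * Xs ^ 4 * e ^ 5 * q ^ 2 + (144) * X ^ 8 * Xs ^ 4 * q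 ^ 2 * t ^ 2 + (-96) * X ^ 9 * Xs ^ 3 * d * e * q ^ 2 * t ^ 2 + (144) * X ^ 9 * Xs ^ 3 * d * e ^ 2 * q ^ 2 * t + (192) * X ^ 9 * Xs ^ 3 * d * e ^ 3 * q ^ 2 * t + (-72) * X ^ 9 * Xs ^ 3 * d * e ^ 4 * q ^ 2 + (-96) * X ^ 9 * Xs ^ 3 * d * e ^ 5 * q ^ 2 + (-72) * X ^ 9 * Xs ^ 3 * d * q ^ 2 * t ^ 2 + (-144) * X ^ 10 * Xs ^ 3 * e * q ^ 2 * t ^ 2 + (-192) * X ^ 10 * Xs ^ 3 * e ^ 2 * q ^ 2 * t ^ 2 + (288) * X ^ 10 * Xs ^ 3 * e ^ 3 * q ^ 2 * t + (384) * X ^ 10 * Xs ^ 3 * e ^ 4 * q ^ 2 * t + (-144) * X ^ 10 * Xs ^ 3 * e ^ 5 * q ^ 2 + (-192) * X ^ 10 * Xs ^ 3 * e ^ 6 * q ^ 2 + (72) * X ^ 11 * Xs ^ 2 * d * e * q ^ 2 * t ^ 2 + (96) * X ^ 11 * Xs ^ 2 * d * e ^ 2 * q ^ 2 * t ^ 2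 + (-144) * X ^ 11 * Xs ^ 2 * d * e ^ 3 * q ^ 2 * t + (-192) * X ^ 11 * Xs ^ 2 * d * e ^ 4 * q ^ 2 * t + (72) * X ^ 11 * Xs ^ 2 * d * e ^ 5 * q ^ 2 + (96) * X ^ 11 * Xs ^ 2 * d * e ^ 6 * q ^ 2 + (64) * X ^ 12 * Xs ^ 2 * e * q ^ 2 * t ^ 3 + (-144) * X ^ 12 * Xs ^ 2 * e ^ 2 * q ^ 2 * t ^ 2 + (-192) * X ^ 12 * Xs ^ 2 * e ^ 3 * q ^ 2 * t ^ 2 + (144) * X ^ 12 * Xs ^ 2 * e ^ 4 * q ^ 2 * t + (192) * X ^ 12 * Xs ^ 2 * e ^ 5 * q ^ 2 * t + (-48) * X ^ 12 * Xs ^ 2 * e ^ 6 * q ^ 2 + (-64) * X ^ 12 * Xs ^ 2 * e ^ 7 * q ^ 2 + (48) * X ^ 12 * Xs ^ 2 * q ^ 2 * t ^ 3 + (-32) * X ^ 13 * Xs * d * e * q ^ 2 * t ^ 3 + (72) * X ^ 13 * Xs * d * e ^ 2 * q ^ 2 * t ^ 2 + (96) * X ^ 13 * Xs * d * e ^ 3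 * q ^ 2 * t ^ 2 + (-72) * X ^ 13 * Xs * d * e ^ 4 * q ^ 2 * t + (-96) * X ^ 13 * Xs * d * e ^ 5 * q ^ 2 * t + (24) * X ^ 13 * Xs * d * e ^ 6 * q ^ 2 + (32) * X ^ 13 * Xs * d * e ^ 7 * q ^ 2 + (-24) * X ^ 13 * Xs * d * q ^ 2 * t ^ 3 + (-48) * X ^ 14 * Xs * e * q ^ 2 * t ^ 3 + (-64) * X ^ 14 * Xs * e ^ 2 * q ^ 2 * t ^ 3 + (144) * X ^ 14 * Xs * e ^ 3 * q ^ 2 * t ^ 2 + (192) * X ^ 14 * Xs * e ^ 4 * q ^ 2 * t ^ 2 + (-144) * X ^ 14 * Xs * e ^ 5 * q ^ 2 * t + (-192) * X ^ 14 * Xs * e ^ 6 * q ^ 2 * t + (48) * X ^ 14 * Xs * e ^ 7 * q ^ 2 + (64) * X ^ 14 * Xs * e ^ 8 * q ^ 2 + (24) * X ^ 15 * d * e * q ^ 2 * t ^ 3 + (32) * X ^ 15 * d * e ^ 2 * q ^ 2 * t ^ 3 + (-72) * X ^ 15 * d * e ^ 3 * q ^ 2 * t ^ 2 + (-96) * X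 ^ 15 * d * e ^ 4 * q ^ 2 * t ^ 2 + (72) * X ^ 15 * d * e ^ 5 * q ^ 2 * t + (96) * X ^ 15 * d * e ^ 6 * q ^ 2 * t + (-24) * X ^ 15 * d * e ^ 7 * q ^ 2 + (-32) * X ^ 15 * d * e ^ 8 * q ^ 2 + (64) * Xs ^ 8 * e * q ^ 2 + (48) * Xs ^ 8 * q ^ 2) * hq

end Identities

/-! ### §2. The CM `2`-isogeny datum of `X₀(49)` over `ℚ_p` -/

section Datum

variable {p : ℕ} [Fact p.Prime]

/-- The `a`-invariants of `49a1 ⊗ ℚ_p`. [folklore] -/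
private theorem cm7_baseChange_a :
    (cm7.baseChange ℚ_[p]).a₁ = 1 ∧ (cm7.baseChange ℚ_[p]).a₂ = -1 ∧ (cm7.baseChange ℚ_[p]).a₃ = 0 ∧
      (cm7.baseChange ℚ_[p]).a₄ = -2 ∧ (cm7.baseChange ℚ_[p]).a₆ = -1 := by
  refine ⟨?_, ?_, ?_, ?_, ?_⟩ <;> simp [WeierstrassCurve.baseChange, WeierstrassCurve.map]

/-- If `log_W(T) = ϖ·log_W` then `T = exp_W(ϖ·log_W) = [ϖ]`, hence `T ∈ ℤ_p⟦z⟧` for `ϖ ∈ ℤ_p`.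
[cite: SilvermanAEC2009, IV.5] [folklore] -/
private theorem isPadicInt_of_formalLog_subst_eq (V : WeierstrassCurve ℚ_[p]) [V.IsIntegral ℤ_[p]]
    {T : ℚ_[p]⟦X⟧} {ϖ : ℚ_[p]} (hT0 : constantCoeff T = 0)
    (hlog : V.formalLog.subst T = C ϖ * V.formalLog) (hϖ : ‖ϖ‖ ≤ 1) : IsPadicInt T := by
  have hs : HasSubst T := HasSubst.of_constantCoeff_zero' hT0
  have hT : T = V.formalExp.subst (C ϖ * V.formalLog) := by
    have e1 := subst_comp_subst_apply (HasSubst.of_constantCoeff_zero' V.constantCoeff_formalLog) hs V.formalExp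
    rw [V.formalExp_subst_formalLog, subst_X hs, hlog] at e1
    exact e1
  rw [hT]
  exact V.isPadicInt_formalExp_subst_C_mul_formalLog hϖ

set_option maxHeartbeats 1600000 in
/-- **The CM `2`-isogeny datum of `X₀(49) = [1,-1,0,-2,-1]` over `ℚ_p`** (any prime `p` at which
the étale `2`-torsion abscissa is `p`-adic, i.e. a root `e ∈ ℚ_p` of `4e² + 5e + 2`): with
`ϖ = 3 + 4e` (a root of `ϖ² - ϖ + 2`, i.e. `(1 ± √-7)/2`) and Vélu's `t = -(14 + 21e)/4` there is
`T ∈ zℚ_p⟦z⟧` with `log_W(T) = ϖ·log_W` (so `T = [ϖ]`) and `ϖ²·x(T) = x + t/(x - e) + e` — the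
complex multiplication `[(1 ± √-7)/2]` of `X₀(49)` as the composite of Vélu's `2`-isogeny with kernel
`{O, (e, ·)}` and the isomorphism `u = ϖ⁻¹, r = eϖ⁻²` back to the curve, read on the formal group.
Construction: `T = 2ϖzAB/Q`, `X(T) = 4AB³/Q²` (`A = X - ez²`, `B = X² + (t - e²)z⁴`,
`Q = -(A² - tz⁴)Ỹ + ϖzAB`), verified by the uniqueness of the formal chart
(`formalXMulSq_subst_eq_of_sq_eq`) and the chain rule. [Vélu 1971; Silverman AEC III.4, IV.1;
Perrin-Riou 1984, Ch. III §1.2] [cite: Perrinriou1984, Ch. III §1.2] -/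
theorem cm7_exists_cmTwoIsogenyDatum {e : ℚ_[p]} (he : 4 * e ^ 2 + 5 * e + 2 = 0) :
    ∃ T : ℚ_[p]⟦X⟧, constantCoeff T = 0 ∧
      (cm7.baseChange ℚ_[p]).formalLog.subst T = C (3 + 4 * e) * (cm7.baseChange ℚ_[p]).formalLog ∧
      C (3 + 4 * e) ^ 2 * (cm7.baseChange ℚ_[p]).formalXMulSq.subst T *
          (X ^ 2 * ((cm7.baseChange ℚ_[p]).formalXMulSq - C e * X ^ 2)) =
        T ^ 2 * ((cm7.baseChange ℚ_[p]).formalXMulSq * ((cm7.baseChange ℚ_[p]).formalXMulSq - C e * X ^ 2) +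
          C (-(14 + 21 * e) / 4) * X ^ 4 +
          C e * X ^ 2 * ((cm7.baseChange ℚ_[p]).formalXMulSq - C e * X ^ 2)) := by
  set E := cm7.baseChange ℚ_[p] with hE
  obtain ⟨ha₁, ha₂, ha₃, ha₄, ha₆⟩ := cm7_baseChange_a (p := p)
  set t : ℚ_[p] := -(14 + 21 * e) / 4 with ht_def
  set Xs := E.formalXMulSq with hXs
  -- constants at the level of power series
  have heC : 4 * (C e : ℚ_[p]⟦X⟧) ^ 2 + 5 * C e + 2 = 0 := by
    have := congrArg (C (R := ℚ_[p])) he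
    simpa only [map_add, map_mul, map_pow, map_ofNat, map_zero] using this
  have htC : 4 * (C t : ℚ_[p]⟦X⟧) = -14 - 21 * C e := by
    have h4 : 4 * t = -14 - 21 * e := by rw [ht_def]; ring
    have := congrArg (C (R := ℚ_[p])) h4
    simpa only [map_sub, map_mul, map_ofNat, map_neg] using this
  have hϖC : (C (3 + 4 * e) : ℚ_[p]⟦X⟧) = 3 + 4 * C e := by
    simp only [map_add, map_mul, map_ofNat]
  -- the Weierstrass relation of `X = z²x`
  have hcurve : Xs ^ 2 = Xs ^ 3 + X * Xs ^ 2 - X ^ 2 * Xs ^ 2 - 2 * X ^ 4 * Xs - X ^ 6 := by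
    have h := E.formalXMulSq_sq_eq
    rw [ha₁, ha₂, ha₃, ha₄, ha₆] at h
    simp only [map_one, map_neg, map_zero, map_ofNat, one_mul, zero_mul, add_zero] at h
    rw [← hXs] at h
    linear_combination h
  have hXs0 : constantCoeff Xs = 1 := by rw [hXs]; exact E.constantCoeff_formalXMulSq
  -- `Φ`
  have hΦ16 := phi_identity X Xs (C e) (C t) hcurve heC htC
  have h16 : (16 : ℚ_[p]⟦X⟧) ≠ 0 := by
    rw [show (16 : ℚ_[p]⟦X⟧) = C (16 : ℚ_[p]) by simp [map_ofNat]]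
    exact fun h => by
      have := C_injective (h.trans (map_zero C).symm)
      norm_num at this
  have hΦ : (-((Xs - C e * X ^ 2) ^ 2 - C t * X ^ 4) * ((X - 2) * Xs) + (3 + 4 * C e) * X * (Xs - C e * X ^ 2) * (Xs ^ 2 + (C t - C e ^ 2) * X ^ 4)) ^ 2 = (4 * (Xs - C e * X ^ 2) * (Xs ^ 2 + (C t - C e ^ 2) * X ^ 4) ^ 3 + 2 * (3 + 4 * C e) * X * (Xs - C e * X ^ 2) * (Xs ^ 2 + (C t - C e ^ 2) * X ^ 4) * (-((Xs - C e * X ^ 2) ^ 2 - C t * X ^ 4) * ((X - 2) * Xs) + (3 + 4 * C e) * X * (Xs - C e * X ^ 2) * (Xs ^ 2 + (C t - C e ^ 2) * X ^ 4)) - 4 * (3 + 4 * C e) ^ 2 * X ^ 2 * (Xs - C e * X ^ 2) ^ 2 * (Xs ^ 2 + (C t - C e ^ 2) * X ^ 4) ^ 2 - 8 * (3 + 4 * C e) ^ 4 * X ^ 4 * (Xs - C e * X ^ 2) ^ 3 * (Xs ^ 2 + (C t - C e ^ 2) * X ^ 4) - 4 * (3 + 4 * C e) ^ 6 * X ^ 6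 * (Xs - C e * X ^ 2) ^ 4) := sub_eq_zero.mp ((mul_eq_zero.mp hΦ16).resolve_left h16)
  -- `Q` is invertible: `Q(0) = 2`
  have hQ0 : constantCoeff (-((Xs - C e * X ^ 2) ^ 2 - C t * X ^ 4) * ((X - 2) * Xs) + (3 + 4 * C e) * X * (Xs - C e * X ^ 2) * (Xs ^ 2 + (C t - C e ^ 2) * X ^ 4)) = 2 := by
    simp only [map_add, map_sub, map_mul, map_pow, map_neg, constantCoeff_C, constantCoeff_X, hXs0,
      map_ofNat]
    norm_num
  have h2 : (2 : ℚ_[p]) ≠ 0 := two_ne_zero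
  set iQ := invOfUnit (-((Xs - C e * X ^ 2) ^ 2 - C t * X ^ 4) * ((X - 2) * Xs) + (3 + 4 * C e) * X * (Xs - C e * X ^ 2) * (Xs ^ 2 + (C t - C e ^ 2) * X ^ 4)) (Units.mk0 (2 : ℚ_[p]) h2) with hiQ
  have hQi : (-((Xs - C e * X ^ 2) ^ 2 - C t * X ^ 4) * ((X - 2) * Xs) + (3 + 4 * C e) * X * (Xs - C e * X ^ 2) * (Xs ^ 2 + (C t - C e ^ 2) * X ^ 4)) * iQ = 1 := mul_invOfUnit _ _ (by rw [hQ0, Units.val_mk0])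
  have hiQ0 : constantCoeff iQ = 2⁻¹ := by
    rw [hiQ, constantCoeff_invOfUnit, Units.val_inv_eq_inv_val, Units.val_mk0]
  -- the parameter `τ = 2ϖzAB/Q` of the image point and `P = X(τ) = 4AB³/Q²`
  set τ := (2 * (3 + 4 * C e) * X * (Xs - C e * X ^ 2) * (Xs ^ 2 + (C t - C e ^ 2) * X ^ 4) * iQ) with hτ
  set P := (4 * (Xs - C e * X ^ 2) * (Xs ^ 2 + (C t - C e ^ 2) * X ^ 4) ^ 3 * iQ ^ 2) with hP
  have hτ0 : constantCoeff τ = 0 := by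
    rw [hτ]; simp only [map_mul, constantCoeff_X, mul_zero, zero_mul]
  have hP0 : constantCoeff P = 1 := by
    rw [hP]
    simp only [map_mul, map_pow, map_add, map_sub, constantCoeff_C, constantCoeff_X, hXs0, hiQ0,
      map_ofNat]
    norm_num
  -- `heq` and the chart: `X(τ) = P`
  have heq : P ^ 2 = P ^ 3 + τ * P ^ 2 - τ ^ 2 * P ^ 2 - 2 * τ ^ 4 * P - τ ^ 6 :=
    heq_identity X (Xs - C e * X ^ 2) (Xs ^ 2 + (C t - C e ^ 2) * X ^ 4) (-((Xs - C e * X ^ 2) ^ 2 - C t * X ^ 4) * ((X - 2) * Xs) + (3 + 4 * C e) * X * (Xs - C e * X ^ 2) * (Xs ^ 2 + (C t - C e ^ 2) * X ^ 4)) iQ (3 + 4 * C e) hΦ hQi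
  have heq' : P ^ 2 = P ^ 3 + C E.a₁ * τ * P ^ 2 + C E.a₂ * τ ^ 2 * P ^ 2 + C E.a₃ * τ ^ 3 * P +
      C E.a₄ * τ ^ 4 * P + C E.a₆ * τ ^ 6 := by
    rw [ha₁, ha₂, ha₃, ha₄, ha₆]
    simp only [map_one, map_neg, map_zero, map_ofNat, one_mul, zero_mul, add_zero]
    linear_combination heq
  have hXP : Xs.subst τ = P := by rw [hXs]; exact E.formalXMulSq_subst_eq_of_sq_eq hτ0 hP0 heq'
  -- the invariant differential along `τ`: `ϖ·η(τ) = τ'·η`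
  have hchart := E.formalEta_subst_mul_eq hτ0 hP0 heq'
  rw [ha₁, ha₃] at hchart
  simp only [map_one, map_zero, one_mul, zero_mul, add_zero] at hchart
  set DXs := d⁄dX ℚ_[p] Xs with hDXs
  set DiQ := d⁄dX ℚ_[p] iQ with hDiQ
  have hD2 : d⁄dX ℚ_[p] (2 : ℚ_[p]⟦X⟧) = 0 := Derivation.map_natCast _ 2
  have hD3 : d⁄dX ℚ_[p] (3 : ℚ_[p]⟦X⟧) = 0 := Derivation.map_natCast _ 3
  have hD4 : d⁄dX ℚ_[p] (4 : ℚ_[p]⟦X⟧) = 0 := Derivation.map_natCast _ 4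
  have hdτ : d⁄dX ℚ_[p] τ = (2 * (3 + 4 * C e) * ((Xs - C e * X ^ 2) * (Xs ^ 2 + (C t - C e ^ 2) * X ^ 4) * iQ + X * ((DXs - 2 * C e * X) * (Xs ^ 2 + (C t - C e ^ 2) * X ^ 4) * iQ + (Xs - C e * X ^ 2) * (2 * Xs * DXs + 4 * (C t - C e ^ 2) * X ^ 3) * iQ + (Xs - C e * X ^ 2) * (Xs ^ 2 + (C t - C e ^ 2) * X ^ 4) * DiQ))) := by
    rw [hτ]
    simp only [Derivation.leibniz, Derivation.leibniz_pow, map_add, map_sub, derivative_C,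
      derivative_X, hD2, hD3, hD4, smul_eq_mul, nsmul_eq_mul, ← hDXs, ← hDiQ]
    ring
  have hdP : d⁄dX ℚ_[p] P = (4 * ((DXs - 2 * C e * X) * (Xs ^ 2 + (C t - C e ^ 2) * X ^ 4) ^ 3 * iQ ^ 2 + 3 * (Xs - C e * X ^ 2) * (Xs ^ 2 + (C t - C e ^ 2) * X ^ 4) ^ 2 * (2 * Xs * DXs + 4 * (C t - C e ^ 2) * X ^ 3) * iQ ^ 2 + 2 * (Xs - C e * X ^ 2) * (Xs ^ 2 + (C t - C e ^ 2) * X ^ 4) ^ 3 * iQ * DiQ)) := by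
    rw [hP]
    simp only [Derivation.leibniz, Derivation.leibniz_pow, map_add, map_sub, derivative_C,
      derivative_X, hD4, smul_eq_mul, nsmul_eq_mul, ← hDXs, ← hDiQ]
    ring
  have hstar := star_identity X Xs (C e) (C t) iQ DXs DiQ hQi
  rw [← hdτ, ← hdP, ← hτ, ← hP] at hstar
  have hYt : E.formalEta * (X * DXs - 2 * Xs) = (X - 2) * Xs := by
    have h := E.formalEta_mul_sub_eq_formalYTilde
    rw [formalYTilde_def, ha₁, ha₃] at h
    simp only [map_one, map_zero, one_mul, zero_mul, add_zero] at h
    rw [← hXs, ← hDXs] at h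
    exact h
  have hkey : (τ - 2) * P * (X * DXs - 2 * Xs) *
      ((3 + 4 * C e) * E.formalEta.subst τ - d⁄dX ℚ_[p] τ * E.formalEta) = 0 := by
    linear_combination (-(E.formalEta.subst τ)) * hstar + ((X - 2) * Xs) * hchart -
      (d⁄dX ℚ_[p] τ * ((τ - 2) * P)) * hYt
  have hne1 : (τ - 2) * P ≠ 0 := by
    intro h
    have := congrArg constantCoeff h
    rw [map_mul, map_sub, hτ0, hP0, map_ofNat, map_zero] at this
    norm_num at this
  have hne2 : X * DXs - 2 * Xs ≠ 0 := by
    intro h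
    have := congrArg constantCoeff h
    rw [map_sub, map_mul, constantCoeff_X, zero_mul, map_mul, map_ofNat, hXs, constantCoeff_formalXMulSq,
      map_zero] at this
    norm_num at this
  have hηη : (3 + 4 * C e) * E.formalEta.subst τ = d⁄dX ℚ_[p] τ * E.formalEta :=
    sub_eq_zero.mp ((mul_eq_zero.mp hkey).resolve_left (mul_ne_zero hne1 hne2))
  -- `ω(τ)·τ' = ϖ·ω`
  have hsτ : HasSubst τ := HasSubst.of_constantCoeff_zero' hτ0
  have hηω : E.formalEta * E.formalOmega = 1 := E.formalEta_mul_formalOmega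
  have hηωτ : E.formalEta.subst τ * E.formalOmega.subst τ = 1 := by
    rw [← subst_mul hsτ, hηω, ← coe_substAlgHom hsτ, map_one]
  have hω : E.formalOmega.subst τ * d⁄dX ℚ_[p] τ = C (3 + 4 * e) * E.formalOmega := by
    rw [hϖC]
    linear_combination (E.formalOmega * E.formalOmega.subst τ) * hηη.symm +
      ((3 + 4 * C e) * E.formalOmega) * hηωτ - (d⁄dX ℚ_[p] τ * E.formalOmega.subst τ) * hηω
  -- `log_W(τ) = ϖ·log_W`
  haveI : IsAddTorsionFree ℚ_[p]⟦X⟧ := IsAddTorsionFree.of_module_rat (M := ℚ_[p]⟦X⟧)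
  have hlog : E.formalLog.subst τ = C (3 + 4 * e) * E.formalLog := by
    have hR : d⁄dX ℚ_[p] (C (3 + 4 * e) * E.formalLog) = C (3 + 4 * e) * E.formalOmega := by
      rw [Derivation.leibniz, derivative_C, smul_zero, add_zero, smul_eq_mul, derivative_formalLog]
    refine derivative.ext ?_ ?_
    · rw [derivative_subst ℚ_[p] hsτ, derivative_formalLog, hR]
      exact hω
    · rw [Literature.RingTheory.FormalGroups.constantCoeff_subst_of_constantCoeff_eq_zero hτ0, map_mul,
        E.constantCoeff_formalLog, mul_zero]
  refine ⟨τ, hτ0, hlog, ?_⟩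
  -- the `x`-relation
  rw [hXP, hP, hτ]
  have htC' : (C (-(14 + 21 * e) / 4) : ℚ_[p]⟦X⟧) = C t := by rw [ht_def]
  rw [htC', hϖC]
  ring

end Datum

/-! ### §3. At `p = 2`: `(σ², 0)` is a Mazur–Tate sigma-squared pair of `X₀(49) ⊗ ℚ₂` for the CM
sigma function `σ` (Perrin-Riou's Lemme 2 at `v | 2`), and it is `(Σ₂, c₂)` under the printed uniqueness -/

section Two

/-- `√-7 ∈ ℤ₂` in the form used here: the étale `2`-torsion abscissa of `49a1` is a `2`-adic integer,
i.e. `4e² + 5e + 2` has a root `e ∈ ℤ₂` (Hensel at `e₀ = 0`: `|F(0)| = |2| = 1/2 < 1 = |F'(0)|² = |5|²`).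
[Serre 1973, Ch. II §3.3 Thm. 4; folklore] [cite: Serre1973, Ch. II §3.3 Thm. 4] -/
private theorem exists_cm7TwoTorsionX_two : ∃ e : ℚ_[2], ‖e‖ ≤ 1 ∧ 4 * e ^ 2 + 5 * e + 2 = 0 := by
  let F : Polynomial ℤ_[2] := Polynomial.C 4 * Polynomial.X ^ 2 + Polynomial.C 5 * Polynomial.X + Polynomial.C 2
  have hF : ∀ z : ℤ_[2], F.aeval z = 4 * z ^ 2 + 5 * z + 2 := by intro z; simp [F]
  have hF' : F.derivative.aeval (0 : ℤ_[2]) = 5 := by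
    simp [F]
  have hnorm : ‖F.aeval (0 : ℤ_[2])‖ < ‖F.derivative.aeval (0 : ℤ_[2])‖ ^ 2 := by
    rw [hF, hF']
    have h2 : ‖(2 : ℤ_[2])‖ = (2 : ℝ)⁻¹ := by
      rw [show (2 : ℤ_[2]) = ((2 : ℕ) : ℤ_[2]) by norm_num, PadicInt.norm_p]; norm_num
    have h5 : ‖(5 : ℤ_[2])‖ = 1 := by
      rw [show (5 : ℤ_[2]) = ((5 : ℕ) : ℤ_[2]) by norm_num, PadicInt.norm_natCast_eq_one_iff]; decide
    rw [show (4 : ℤ_[2]) * 0 ^ 2 + 5 * 0 + 2 = 2 by ring, h2, h5]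
    norm_num
  obtain ⟨z, hz, -⟩ := hensels_lemma hnorm
  refine ⟨(z : ℚ_[2]), PadicInt.norm_le_one z, ?_⟩
  rw [hF] at hz
  have := congrArg ((↑) : ℤ_[2] → ℚ_[2]) hz
  push_cast at this
  exact this

/-- `ϖ = 3 + 4e = (1 ± √-7)/2` is a `2`-adic unit for `e ∈ ℤ₂`. [folklore] -/
private theorem norm_three_add_four_mul {e : ℚ_[2]} (he : ‖e‖ ≤ 1) : ‖(3 : ℚ_[2]) + 4 * e‖ = 1 := by
  have h3 : ‖(3 : ℚ_[2])‖ = 1 := by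
    rw [show (3 : ℚ_[2]) = ((3 : ℕ) : ℚ_[2]) by norm_num, Padic.norm_natCast_eq_one_iff]; decide
  have h4 : ‖(4 : ℚ_[2]) * e‖ < 1 := by
    have h4' : ‖(4 : ℚ_[2])‖ < 1 := by
      rw [show (4 : ℚ_[2]) = ((4 : ℕ) : ℚ_[2]) by norm_num, Padic.norm_natCast_lt_one_iff]; decide
    rw [norm_mul]
    calc ‖(4 : ℚ_[2])‖ * ‖e‖ ≤ ‖(4 : ℚ_[2])‖ * 1 := by gcongr
      _ < 1 := by rw [mul_one]; exact h4'
  have hne : ‖(3 : ℚ_[2])‖ ≠ ‖(4 : ℚ_[2]) * e‖ := by rw [h3]; exact (ne_of_lt h4).symm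
  rw [Padic.add_eq_max_of_ne hne, h3, max_eq_left h4.le]

variable {p : ℕ} [Fact p.Prime]

/-- **Every Weierstrass curve over `ℚ_p` has a normalised odd formal solution of the sigma equation
with constant EXACTLY `0`**, `x = -D(Dσ/σ)`: twist the tree's solution `(σ₁, c₁)`
(`exists_isFormallyOdd_satisfiesSigmaODE`) by `exp((c₁/2)·log_W²)`, which shifts the constant by `-c₁`
(the one-parameter family of formal solutions of Mazur–Tate's equation). [Mazur–Stein–Tate 2006, §3.1;
Mazur–Tate 1991, §3] [cite: MazurSteinTate2006, Thm. 1.3] -/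
theorem exists_isFormallyOdd_satisfiesSigmaODE_zero (V : WeierstrassCurve ℚ_[p]) :
    ∃ σ : ℚ_[p]⟦X⟧, constantCoeff σ = 0 ∧ coeff 1 σ = 1 ∧ V.IsFormallyOdd σ ∧ V.SatisfiesSigmaODE σ 0 := by
  obtain ⟨σ₁, c₁, h0, h1, hodd, hODE⟩ := V.exists_isFormallyOdd_satisfiesSigmaODE
  obtain ⟨h0', h1', hODE'⟩ := hODE.mul_exp_subst h0 h1 (c₁ / 2)
  refine ⟨_, h0', h1', hodd.mul_exp_subst (c₁ / 2), ?_⟩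
  convert hODE' using 2
  ring

/-- **Perrin-Riou's Lemme 2 for `X₀(49)` at `v | 2`, squared currency: `(σ², 0)` IS a Mazur–Tate
sigma-squared pair of `X₀(49) ⊗ ℚ₂`** for every normalised odd formal solution `σ = z + ⋯ ∈ ℚ₂⟦z⟧` of
the sigma equation `x = -D(Dσ/σ)` of the minimal model `[1,-1,0,-2,-1]` (constant `c = 0`, i.e.
`s₂ = 1/4` on this model ⇔ Perrin-Riou's `s₂ = 1/2` on `y² = 4x³ - 35x - 49`, table p. 54): `σ²` has
all its coefficients in `ℤ₂`, `σ² = z² + a₁z³ + ⋯`, it is even under `[−1]` and satisfies the squared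
sigma equation. Proof = her proof with `π* = ϖ = (1 ± √-7)/2 ∈ ℤ₂^×`, `N(π*) = 2 = p`: the CM
`2`-isogeny datum of §2 (`[ϖ]` on the formal group, from Vélu's formulas) feeds the tree's
`isMazurTateSigmaSqPair_sq_of_cmTwoIsogeny_two` (functional equation `z²σ([ϖ]t)² = ϖ²σ⁴·(X - ez²)`
+ the coefficient induction «`1 - (π*^m - p)a_m t^m`» of `UnitSubstitutionIntegrality`), binder-free —
no appeal to Mazur–Tate («nous en donnons ici une démonstration indépendante», p. 54).
[Perrin-Riou 1984, Ch. III §1.2 Lemme 2 (pp. 54–55) and table p. 54]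
[cite: Perrinriou1984, Ch. III §1.2 Lemme 2] -/
theorem cm7_isMazurTateSigmaSqPair_sq_two {σ : ℚ_[2]⟦X⟧} (hσ0 : constantCoeff σ = 0)
    (hσ1 : coeff 1 σ = 1) (hodd : (cm7.baseChange ℚ_[2]).IsFormallyOdd σ)
    (hODE : (cm7.baseChange ℚ_[2]).SatisfiesSigmaODE σ 0) :
    (cm7.baseChange ℚ_[2]).IsMazurTateSigmaSqPair (σ ^ 2) 0 := by
  haveI := cm7_isGloballyMinimal
  obtain ⟨e, he1, he⟩ := exists_cm7TwoTorsionX_two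
  obtain ⟨T, hT0, hlog, hx⟩ := cm7_exists_cmTwoIsogenyDatum (p := 2) he
  obtain ⟨ha₁, ha₂, ha₃, ha₄, ha₆⟩ := cm7_baseChange_a (p := 2)
  have hϖ : ‖(3 : ℚ_[2]) + 4 * e‖ = 1 := norm_three_add_four_mul he1
  have hT : IsPadicInt T := isPadicInt_of_formalLog_subst_eq _ hT0 hlog hϖ.le
  have hb₂ : (cm7.baseChange ℚ_[2]).b₂ = -3 := by rw [b₂, ha₁, ha₂]; norm_num
  have hb₄ : (cm7.baseChange ℚ_[2]).b₄ = -4 := by rw [b₄, ha₁, ha₃, ha₄]; norm_num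
  have hb₆ : (cm7.baseChange ℚ_[2]).b₆ = -4 := by rw [b₆, ha₃, ha₆]; norm_num
  refine isMazurTateSigmaSqPair_sq_of_cmTwoIsogeny_two (cm7.baseChange ℚ_[2]) hσ0 hσ1 hodd hODE hT0 hT
    hlog hϖ he1 (t := -(14 + 21 * e) / 4) (r₀ := e) ?_ ?_ hx ?_
  · rw [hb₂, hb₄, hb₆]; linear_combination (e - 2) * he
  · rw [hb₂, hb₄]; linear_combination (-3 / 2 : ℚ_[2]) * he
  · ring

/-- **Binder-free existence of the CM sigma function of `X₀(49) ⊗ ℚ₂` and of its squared pair**: there is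
a normalised odd `σ ∈ z + z²ℚ₂⟦z⟧` with `x = -D(Dσ/σ)` on `[1,-1,0,-2,-1]`, and `(σ², 0)` is a Mazur–Tate
sigma-squared pair (`σ² ∈ z² + z³ℤ₂⟦z⟧`). [Perrin-Riou 1984, Ch. III §1.2 (définition de `σ_v`, p. 53)
and Lemme 2] [cite: Perrinriou1984, Ch. III §1.2 Lemme 2] -/
theorem cm7_exists_isMazurTateSigmaSqPair_sq_two :
    ∃ σ : ℚ_[2]⟦X⟧, constantCoeff σ = 0 ∧ coeff 1 σ = 1 ∧ (cm7.baseChange ℚ_[2]).IsFormallyOdd σ ∧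
      (cm7.baseChange ℚ_[2]).SatisfiesSigmaODE σ 0 ∧
      (cm7.baseChange ℚ_[2]).IsMazurTateSigmaSqPair (σ ^ 2) 0 := by
  obtain ⟨σ, h0, h1, hodd, hODE⟩ := (cm7.baseChange ℚ_[2]).exists_isFormallyOdd_satisfiesSigmaODE_zero
  exact ⟨σ, h0, h1, hodd, hODE, cm7_isMazurTateSigmaSqPair_sq_two h0 h1 hodd hODE⟩

/-- **`(Σ₂, c₂) = (padicSigmaSq, padicSigmaSqConst)` of `X₀(49) ⊗ ℚ₂` IS a sigma-squared pair —
WITHOUT the printed uniqueness binder `mazurTate_sigmaSq_existsUnique_two`** (compare the tree's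
`cm7_exists_isMazurTateSigmaSqPair_two (hMT)`): the receptacle is inhabited by `(σ_CM², 0)`.
[Perrin-Riou 1984, Ch. III §1.2 Lemme 2; Silverman 2005, §5 Rem. 2] [cite: Perrinriou1984, Ch. III §1.2 Lemme 2] -/
theorem cm7_isMazurTateSigmaSqPair_padicSigmaSq_two' :
    (cm7.baseChange ℚ_[2]).IsMazurTateSigmaSqPair (cm7.baseChange ℚ_[2]).padicSigmaSq
      (cm7.baseChange ℚ_[2]).padicSigmaSqConst := by
  obtain ⟨σ, -, -, -, -, h⟩ := cm7_exists_isMazurTateSigmaSqPair_sq_two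
  exact isMazurTateSigmaSqPair_padicSigmaSq (Or.inr ⟨σ ^ 2, 0, h⟩)

/-- **(L1) at `p = 2` for `X₀(49)`: `σ_MT² = σ_CM²` and `c₂ = 0`.** Under the printed uniqueness of the
sigma-squared division series at `2` (`mazurTate_sigmaSq_existsUnique_two`, Silverman 2005 §5 Rem. 2 /
Mazur–Tate 1991 Thm. 3.1), the tree's canonical squared `2`-adic sigma function of `X₀(49) ⊗ ℚ₂` is the
square of Perrin-Riou's CM sigma function `σ_v`, `v | 2`, and its constant is `0` (`s₂ = 1/4` on the
minimal model): the `2`-adic sigma-squared height of the tree on `X₀(49)` is the one built from `σ_v`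
(the `v`-part of her `h_ρ`, pp. 56–57). [Perrin-Riou 1984, Ch. III §1.2 («le lemme suivant se déduit des résultats de Mazur et
Tate sur les fonctions σ p-adiques»), Lemme 2; Mazur–Tate 1991, Thm. 3.1]
[cite: Perrinriou1984, Ch. III §1.2 Lemme 2] [cite: Silverman2005DivPoly, §5 Rem. 2] -/
theorem cm7_padicSigmaSq_eq_sq_two (hMT : mazurTate_sigmaSq_existsUnique_two) {σ : ℚ_[2]⟦X⟧}
    (hσ0 : constantCoeff σ = 0) (hσ1 : coeff 1 σ = 1) (hodd : (cm7.baseChange ℚ_[2]).IsFormallyOdd σ)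
    (hODE : (cm7.baseChange ℚ_[2]).SatisfiesSigmaODE σ 0) :
    (cm7.baseChange ℚ_[2]).padicSigmaSq = σ ^ 2 ∧ (cm7.baseChange ℚ_[2]).padicSigmaSqConst = 0 := by
  haveI := cm7_isGloballyMinimal
  exact cm7_isMazurTateSigmaSqPair_padicSigmaSq_two'.unique_two hMT cm7_hasGoodReductionAtPrime_two
    cm7_not_two_dvd_frobeniusTrace_two (cm7_isMazurTateSigmaSqPair_sq_two hσ0 hσ1 hodd hODE)

end Two

end WeierstrassCurve
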